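import Summits.AnomalousDissipation.AnomalousDissipation.Theorems.ScalarAnomalySteadySourceFormal.Negative.CellNoGo

/-!
# Negative knowledge for the crux `ScalarAnomalySteadySourceFormal` (stmt-AnomalousDissipation-0448), VIII-e:
# QUANTITATIVE Batchelor no-go — a lower bound on the spectral reach of any witness

Certified copy of §10.5 of the cdisprove work file.  The constants of `Negative.CellNoGo` are explicit
in the band radius `R`, the number of stirring modes `#S` and the coefficient bound `M`; letting them
depend on `j` gives (`growingBand_not_anomalous`): if the stirring of the `j`-th member is a real
trigonometric polynomial on `S_j ⊆ {|k|_∞ ≤ R_j}` with coefficients bounded by `M_j` (continuous,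
transversal) and

* `R_j · #S_j · M_j = o(log (1/ν_j))` (for every `δ > 0`, eventually `R_j #S_j M_j ≤ δ log(1/ν_j)`), and
* `log (R_j + 1) ≤ γ log (1/ν_j)` eventually, for some `γ < 1/2` (support inside the diffusive range),

then bounded scalar variance excludes a dissipation floor (any `L²` data, any weak solutions, one
smooth mean-zero source).  Contrapositive = **necessary condition on witnesses of the crux**: along a
subsequence either the Wiener-type stirring strength `R_j #S_j M_j ≳ log(1/ν_j)` (`‖∇v_j‖_∞`-scale
growth at least logarithmic — the Batchelor threshold) or the Fourier support reaches the diffusive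
scale `ν_j^{-1/2+o(1)}`.  Tool: the explicit harmonic lower bound `log((c+n)/c) ≤ ∑_{x<n} (c+x)⁻¹`
(`log_window_le_harmonic`).

Supports stmt-AnomalousDissipation-0448.
-/

set_option linter.dupNamespace false

noncomputable section

open scoped BigOperators Topology ENNReal NNReal InnerProductSpace ContDiff
open Filter Set Function MeasureTheory UnitAddTorus Complex

namespace Summit.AnomalousDissipation.AnomalousDissipation.Theorems.ScalarAnomalySteadySourceFormal.Negative

open Literature.Analysis
open Literature.Analysis.FunctionSpaces Literature.Analysis.FunctionSpaces.Torus
open Literature.Analysis.FluidPDE Literature.Analysis.FluidPDE.Torus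

/-- The frequency lattice `ℤ²` (local notation). -/
local notation "ℤ²" => Fin 2 → ℤ

section LogWindow

/-- **Harmonic window from below**: `log ((c+n)/c) ≤ ∑_{x<n} (c+x)⁻¹` for `c ≥ 1`. [folklore] -/
theorem log_window_le_harmonic {c : ℕ} (hc : 1 ≤ c) (n : ℕ) :
    Real.log (((c : ℝ) + n) / c) ≤ ∑ x ∈ Finset.range n, ((c : ℝ) + x)⁻¹ := by
  have hc0 : (0 : ℝ) < c := by exact_mod_cast hc
  have htel : ∑ x ∈ Finset.range n, (Real.log ((c : ℝ) + (x + 1 : ℕ)) - Real.log ((c : ℝ) + x)) =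
      Real.log ((c : ℝ) + n) - Real.log c := by
    have := Finset.sum_range_sub (fun x : ℕ => Real.log ((c : ℝ) + x)) n
    simpa using this
  rw [Real.log_div (by positivity) hc0.ne', ← htel]
  refine Finset.sum_le_sum fun x _ => ?_
  have hcx : (0 : ℝ) < c + x := by positivity
  have e : Real.log ((c : ℝ) + (x + 1 : ℕ)) - Real.log ((c : ℝ) + x) = Real.log (((c : ℝ) + x + 1) / ((c : ℝ) + x)) := by
    rw [Real.log_div (by positivity) hcx.ne']
    push_cast
    ring_nf
  rw [e]
  calc Real.log (((c : ℝ) + x + 1) / ((c : ℝ) + x)) ≤ ((c : ℝ) + x + 1) / ((c : ℝ) + x) - 1 :=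
        Real.log_le_sub_one_of_pos (by positivity)
    _ = ((c : ℝ) + x)⁻¹ := by field_simp; ring

end LogWindow

section Budget

/-- **The logarithmic budget of the viscous term** (pure real analysis): with `n ≤ (K₀+R) e^{βΛ} + 1`,
`βΛ ≤ (1/2-γ)/4 · lg`, `log (R+1) ≤ γ lg`, `log (512π²E'/ε) + 2 log 3 + 2 log (K₀+1) ≤ (1/2-γ)/2 · lg`
and `lg = log (1/ν) ≥ 0`, one has `8π²ν(K₀+n)²E' ≤ ε/8`. [folklore] -/
theorem quant_viscous_budget {ε E' γ β Λ lg ν : ℝ} {K₀ R n : ℕ} (hε : 0 < ε) (hE' : 0 < E')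
    (hn1 : 1 ≤ n) (hν : 0 < ν) (hlg : lg = Real.log (1 / ν)) (hΛ0 : 0 ≤ Λ) (hβ0 : 0 ≤ β)
    (hn_le : (n : ℝ) ≤ ((K₀ : ℝ) + R) * Real.exp (β * Λ) + 1)
    (hβΛ : β * Λ ≤ (1 / 2 - γ) / 4 * lg) (hR1 : Real.log ((R : ℝ) + 1) ≤ γ * lg)
    (hC : Real.log (64 * Real.pi ^ 2 * E' * 8 / ε) + 2 * Real.log 3 + 2 * Real.log ((K₀ : ℝ) + 1) ≤ (1 / 2 - γ) / 2 * lg) :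
    8 * Real.pi ^ 2 * ν * ((K₀ : ℝ) + n) ^ 2 * E' ≤ ε / 8 := by
  have hπ := Real.pi_pos
  have hexp1 : 1 ≤ Real.exp (β * Λ) := Real.one_le_exp (by positivity)
  -- `K₀ + n ≤ 3 (K₀+1)(R+1) exp(βΛ)`
  have hK₀0 : (0 : ℝ) ≤ K₀ := K₀.cast_nonneg
  have hR0 : (0 : ℝ) ≤ R := R.cast_nonneg
  have hKR0 : (0 : ℝ) ≤ (K₀ : ℝ) * R := mul_nonneg hK₀0 hR0
  have hPexp : ((K₀ : ℝ) + 1) * ((R : ℝ) + 1) = (K₀ : ℝ) * R + K₀ + R + 1 := by ring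
  have hP1 : (1 : ℝ) ≤ ((K₀ : ℝ) + 1) * ((R : ℝ) + 1) := by rw [hPexp]; linarith
  have hP0 : (0 : ℝ) ≤ ((K₀ : ℝ) + 1) * ((R : ℝ) + 1) := by linarith
  have hc_le : (K₀ : ℝ) + R ≤ ((K₀ : ℝ) + 1) * ((R : ℝ) + 1) := by rw [hPexp]; linarith
  have hK₀P : (K₀ : ℝ) ≤ ((K₀ : ℝ) + 1) * ((R : ℝ) + 1) := by rw [hPexp]; linarith
  have hPe : ((K₀ : ℝ) + 1) * ((R : ℝ) + 1) ≤ ((K₀ : ℝ) + 1) * ((R : ℝ) + 1) * Real.exp (β * Λ) :=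
    le_mul_of_one_le_right hP0 hexp1
  have hce : ((K₀ : ℝ) + R) * Real.exp (β * Λ) ≤ ((K₀ : ℝ) + 1) * ((R : ℝ) + 1) * Real.exp (β * Λ) :=
    mul_le_mul_of_nonneg_right hc_le (Real.exp_pos _).le
  have hKn : (K₀ : ℝ) + n ≤ 3 * (((K₀ : ℝ) + 1) * ((R : ℝ) + 1)) * Real.exp (β * Λ) := by
    linarith [hn_le, hK₀P, hPe, hce, hP1]
  have hKn0 : 0 < (K₀ : ℝ) + n := by have : (1:ℝ) ≤ n := (by exact_mod_cast hn1); linarith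
  have hlogKn : Real.log ((K₀ : ℝ) + n) ≤ Real.log 3 + Real.log ((K₀ : ℝ) + 1) + γ * lg + (1 / 2 - γ) / 4 * lg := by
    calc Real.log ((K₀ : ℝ) + n) ≤ Real.log (3 * (((K₀ : ℝ) + 1) * ((R : ℝ) + 1)) * Real.exp (β * Λ)) :=
          Real.log_le_log hKn0 hKn
      _ = Real.log 3 + Real.log ((K₀ : ℝ) + 1) + Real.log ((R : ℝ) + 1) + β * Λ := by
          rw [Real.log_mul (by positivity) (Real.exp_pos _).ne', Real.log_mul (by norm_num) (by positivity),
            Real.log_mul (by positivity) (by positivity), Real.log_exp]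
          ring
      _ ≤ _ := by linarith
  have hX : 0 < 64 * Real.pi ^ 2 * E' * 8 / ε := by positivity
  have hlogν' : Real.log ν = -lg := by rw [hlg, one_div, Real.log_inv, neg_neg]
  have hposq : 0 < 64 * Real.pi ^ 2 * E' * 8 / ε * (ν * ((K₀ : ℝ) + n) ^ 2) := by positivity
  have hbudget : Real.log (64 * Real.pi ^ 2 * E' * 8 / ε * (ν * ((K₀ : ℝ) + n) ^ 2)) ≤ 0 := by
    rw [Real.log_mul hX.ne' (by positivity), Real.log_mul hν.ne' (by positivity), Real.log_pow, hlogν']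
    push_cast
    nlinarith [hlogKn, hC]
  have hle1 : 64 * Real.pi ^ 2 * E' * 8 / ε * (ν * ((K₀ : ℝ) + n) ^ 2) ≤ 1 :=
    (Real.log_nonpos_iff hposq.le).1 hbudget
  rw [div_mul_eq_mul_div, div_le_one hε] at hle1
  nlinarith [hle1]

end Budget

section Member

variable {S : Finset ℤ²} {R : ℕ} {M : ℝ} {h : UnitAddTorus (Fin 2) → ℝ}

/-- **One member cannot carry the floor** (the numerical heart of all band-limited no-gos): if for
ONE shear/cell-stirred weak solution the three coefficients of `cell_timeMean_diss_le` are each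
`≤ ε/8` on the honest variance level `E' > E`, then `ε ≤ ⟨ν‖∇θ‖²⟩` is impossible. [folklore] -/
theorem cell_member_no_floor {ν : ℝ} (hν : 0 < ν) {c : ℝ → ℤ² → EuclideanSpace ℂ (Fin 2)}
    {u : ℝ → UnitAddTorus (Fin 2) → EuclideanSpace ℝ (Fin 2)} {θ₀ : UnitAddTorus (Fin 2) → ℝ}
    {θ : ℝ → UnitAddTorus (Fin 2) → ℝ} (hw : IsWeakScalarTransportForced ν u (fun _ => h) θ₀ θ)
    (hu : ∀ s, u s = realTrigPoly S (c s)) (hh : IsSmooth h) (hmean : HasZeroMean h) (hθ₀ : MemLp θ₀ 2 volume)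
    (hc : ∀ k, Continuous fun s => c s k) (hM : ∀ s k, ‖c s k‖ ≤ M) (hM0 : 0 ≤ M)
    (htrans : ∀ s, ∀ k ∈ S, zdot k (c s k) = 0) (hS : ∀ k ∈ S, |k 0| ≤ R ∧ |k 1| ≤ R)
    {K₀ n : ℕ} (hKR : 1 ≤ K₀ + R) (hn : 1 ≤ n) {ε E' E : ℝ} (hε : 0 < ε) (hEE' : E < E')
    (hP₁ : 8 * Real.pi ^ 2 * ν * ((K₀ : ℝ) + n) ^ 2 * E' ≤ ε / 8)
    (hP₂ : 8 * Real.pi * R * S.card * M * E' / (∑ x ∈ Finset.range n, ((K₀ : ℝ) + R + x)⁻¹) ≤ ε / 8)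
    (hη : sourceTailMass K₀ K₀ h * ((1 + E') / 2) ≤ ε / 8)
    (hVb : longTimeAvgSup (fun t => scalarL2Sq (θ t)) ≤ E)
    (hfl : ε ≤ longTimeAvgSup (fun t => ν * (eScalarGradNormSq (θ t)).toReal)) : False := by
  have hh2 : MemLp h 2 volume := hh.memLp 2
  have hhi : Integrable h volume := hh.integrable
  have hπ := Real.pi_pos
  -- opaque names for the coefficients
  obtain ⟨η₀, hη₀⟩ : ∃ η₀ : ℝ, η₀ = sourceTailMass K₀ K₀ h := ⟨_, rfl⟩
  have hη₀0 : 0 ≤ η₀ := by rw [hη₀]; exact sourceTailMass_nonneg _ _ _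
  obtain ⟨P₁, hP₁d⟩ : ∃ P₁ : ℝ, P₁ = 8 * Real.pi ^ 2 * ν * ((K₀ : ℝ) + n) ^ 2 := ⟨_, rfl⟩
  obtain ⟨P₂, hP₂d⟩ : ∃ P₂ : ℝ, P₂ = 8 * Real.pi * R * S.card * M / (∑ x ∈ Finset.range n, ((K₀ : ℝ) + R + x)⁻¹) := ⟨_, rfl⟩
  have hHpos : 0 < ∑ x ∈ Finset.range n, ((K₀ : ℝ) + R + x)⁻¹ :=
    Finset.sum_pos (fun x _ => by
      have h0 : (0:ℝ) ≤ x := x.cast_nonneg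
      have h1' : (1:ℝ) ≤ K₀ + R := by exact_mod_cast hKR
      exact inv_pos.2 (by linarith only [h0, h1'])) (Finset.nonempty_range_iff.2 (by omega))
  have hP₁0 : 0 ≤ P₁ := by rw [hP₁d]; exact mul_nonneg (mul_nonneg (by positivity) hν.le) (sq_nonneg _)
  have hP₂0 : 0 ≤ P₂ := by rw [hP₂d]; exact div_nonneg (mul_nonneg (by positivity) hM0) hHpos.le
  have hP₁E : P₁ * E' ≤ ε / 8 := by rw [hP₁d]; exact hP₁
  have hP₂E : P₂ * E' ≤ ε / 8 := by rw [hP₂d, ← div_mul_eq_mul_div] at *; simpa [div_mul_eq_mul_div] using hP₂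
  have h4 : η₀ / 2 * E' + η₀ / 2 ≤ ε / 8 := by
    have e : η₀ / 2 * E' + η₀ / 2 = η₀ * ((1 + E') / 2) := by ring
    rw [e, hη₀]; exact hη
  have hP0 : 0 ≤ P₁ + P₂ + η₀ / 2 := by linarith only [hP₁0, hP₂0, hη₀0]
  have hcoef : (P₁ + P₂ + η₀ / 2) * E' + η₀ / 2 ≤ 3 * ε / 8 := by
    have e : (P₁ + P₂ + η₀ / 2) * E' + η₀ / 2 = P₁ * E' + P₂ * E' + (η₀ / 2 * E' + η₀ / 2) := by ring
    rw [e]; linarith only [hP₁E, hP₂E, h4]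
  -- finiteness of the dissipation integral and honesty of the variance
  have hfin : ∀ T, 0 < T → ∫⁻ t in Ioo 0 T, eScalarGradNormSq (θ t) ≠ ⊤ := by
    intro T hT htop
    have hper := cell_perT_dissipation_le hw hν.le hu hh2 hθ₀ hc hM hM0 htrans hS (K := 0) le_rfl hT
    rw [htop, ENNReal.mul_top (by simpa using hν)] at hper
    exact ENNReal.ofReal_ne_top (top_le_iff.1 hper)
  have hδ' : 0 < E' - E := by linarith only [hEE']
  have hhon := honest_variance hw hν hhi hmean (hθ₀.integrable one_le_two) hfin hε hfl hVb hδ'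
  rw [show E + (E' - E) = E' by ring] at hhon
  -- eventually the dissipation mean is ≤ ε/2
  have hev : ∀ᶠ T in atTop, timeMean (fun t => ν * (eScalarGradNormSq (θ t)).toReal) T ≤ ε / 2 := by
    filter_upwards [hhon, eventually_gt_atTop (0 : ℝ), eventually_ge_atTop (4 * scalarL2Sq θ₀ / ε)]
      with T hVT hT0 hTθ
    have hest : timeMean (fun t => ν * (eScalarGradNormSq (θ t)).toReal) T ≤
        scalarL2Sq θ₀ / (2 * T) + (P₁ + P₂ + η₀ / 2) * timeMean (fun t => scalarL2Sq (θ t)) T + η₀ / 2 := by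
      rw [hP₁d, hP₂d, hη₀]
      exact cell_timeMean_diss_le hν hw hu hh2 hθ₀ hc hM hM0 htrans hS K₀ hKR hn hT0
    have hVT0 : 0 ≤ timeMean (fun t => scalarL2Sq (θ t)) T := timeMean_nonneg (fun t => scalarL2Sq_nonneg _) hT0.le
    have h1 : scalarL2Sq θ₀ / (2 * T) ≤ ε / 8 := by
      rw [div_le_iff₀ (by positivity)]
      have hTθ' : 4 * scalarL2Sq θ₀ / ε ≤ T := hTθ
      rw [div_le_iff₀ hε] at hTθ'
      linarith only [hTθ']
    have h2 : (P₁ + P₂ + η₀ / 2) * timeMean (fun t => scalarL2Sq (θ t)) T + η₀ / 2 ≤ 3 * ε / 8 :=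
      le_trans (add_le_add (mul_le_mul_of_nonneg_left hVT hP0) le_rfl) hcoef
    linarith only [hest, h1, h2]
  -- but frequently it is ≥ 3ε/4
  have hfreq := frequently_le_timeMean_of_le_longTimeAvgSup hε (by positivity : (0 : ℝ) < ε / 4) hfl
  obtain ⟨T, hT1, hT2⟩ := (hfreq.and_eventually hev).exists
  linarith only [hT1, hT2, hε]

end Member

section Growing

variable {h : UnitAddTorus (Fin 2) → ℝ}

/-- **QUANTITATIVE BATCHELOR NO-GO (growing band limits).**  See the file docstring. [folklore] -/
theorem growingBand_not_anomalous (hh : IsSmooth h) (hmean : HasZeroMean h)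
    {S : ℕ → Finset ℤ²} {R : ℕ → ℕ} {M : ℕ → ℝ}
    (hS : ∀ j, ∀ k ∈ S j, |k 0| ≤ R j ∧ |k 1| ≤ R j) (hM0 : ∀ j, 0 ≤ M j)
    {νs : ℕ → ℝ} (hν : ∀ j, 0 < νs j) (hν0 : Tendsto νs atTop (nhds 0))
    (hgrowth : ∀ δ : ℝ, 0 < δ → ∀ᶠ j in atTop, (R j : ℝ) * (S j).card * M j ≤ δ * Real.log (1 / νs j))
    {γ : ℝ} (hγ : γ < 1 / 2) (hreach : ∀ᶠ j in atTop, Real.log ((R j : ℝ) + 1) ≤ γ * Real.log (1 / νs j))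
    {cs : ℕ → ℝ → ℤ² → EuclideanSpace ℂ (Fin 2)} (hc : ∀ j k, Continuous fun s => cs j s k)
    (hM : ∀ j s k, ‖cs j s k‖ ≤ M j) (htrans : ∀ j s, ∀ k ∈ S j, zdot k (cs j s k) = 0)
    {us : ℕ → ℝ → UnitAddTorus (Fin 2) → EuclideanSpace ℝ (Fin 2)} (hu : ∀ j s, us j s = realTrigPoly (S j) (cs j s))
    {θ₀s : ℕ → UnitAddTorus (Fin 2) → ℝ} (hθ₀ : ∀ j, MemLp (θ₀s j) 2 volume)
    {θs : ℕ → ℝ → UnitAddTorus (Fin 2) → ℝ}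
    (hweak : ∀ j, IsWeakScalarTransportForced (νs j) (us j) (fun _ => h) (θ₀s j) (θs j))
    {E : ℝ} (hV : ∀ j, longTimeAvgSup (fun t => scalarL2Sq (θs j t)) ≤ E) :
    ¬ ∃ ε : ℝ, 0 < ε ∧ ∀ j, ε ≤ longTimeAvgSup (fun t => νs j * (eScalarGradNormSq (θs j t)).toReal) := by
  rintro ⟨ε, hε, hfl⟩
  have hh2 : MemLp h 2 volume := hh.memLp 2
  have hhi : Integrable h volume := hh.integrable
  obtain ⟨E', hE'⟩ : ∃ E' : ℝ, E' = max E 0 + 1 := ⟨_, rfl⟩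
  have hE'1 : 1 ≤ E' := by rw [hE']; have := le_max_right E 0; linarith only [this]
  have hE'0 : 0 < E' := by linarith only [hE'1]
  have hπ := Real.pi_pos
  -- (1) the tail cut-off `K₀ = max L 1` (depends on `h`, `ε` only)
  obtain ⟨L, hL⟩ := sourceTailMass_small hh2 (η := ε / (4 * (1 + E'))) (by positivity)
  obtain ⟨K₀, hK₀⟩ : ∃ K₀ : ℕ, K₀ = max L 1 := ⟨_, rfl⟩
  have hK₀1 : 1 ≤ K₀ := by rw [hK₀]; exact le_max_right _ _
  obtain ⟨η₀, hη₀⟩ : ∃ η₀ : ℝ, η₀ = sourceTailMass K₀ K₀ h := ⟨_, rfl⟩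
  have hη₀0 : 0 ≤ η₀ := by rw [hη₀]; exact sourceTailMass_nonneg _ _ _
  have hη₀le : η₀ ≤ ε / (4 * (1 + E')) := by
    rw [hη₀]
    exact (sourceTailMass_mono_sq hh2 (by rw [hK₀]; exact_mod_cast le_max_left L 1)).trans hL
  -- (2) constants: `β` (window target per unit stirring strength) and `δ`
  obtain ⟨β, hβ⟩ : ∃ β : ℝ, β = 64 * Real.pi * E' / ε := ⟨_, rfl⟩
  have hβ0 : 0 < β := by rw [hβ]; positivity
  obtain ⟨δ, hδ⟩ : ∃ δ : ℝ, δ = (1 / 2 - γ) / (4 * β) := ⟨_, rfl⟩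
  have hδ0 : 0 < δ := by rw [hδ]; apply div_pos <;> linarith
  -- (3) choose `j`: growth + reach + ν small
  have hlogν : Tendsto (fun j => Real.log (1 / νs j)) atTop atTop := by
    have h1 : Tendsto (fun j => 1 / νs j) atTop atTop := by
      refine Tendsto.congr' ?_ ((tendsto_inv_nhdsGT_zero).comp (tendsto_nhdsWithin_iff.2 ⟨hν0, Eventually.of_forall fun j => hν j⟩))
      exact Eventually.of_forall fun j => by simp [one_div]
    exact Real.tendsto_log_atTop.comp h1
  obtain ⟨C₁, hC₁⟩ : ∃ C₁ : ℝ, C₁ = Real.log (64 * Real.pi ^ 2 * E' * 8 / ε) + 2 * Real.log 3 + 2 * Real.log ((K₀ : ℝ) + 1) := ⟨_, rfl⟩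
  have hevC : ∀ᶠ j in atTop, C₁ ≤ (1 / 2 - γ) / 2 * Real.log (1 / νs j) :=
    (hlogν.eventually (eventually_ge_atTop (C₁ / ((1 / 2 - γ) / 2)))).mono fun j hj => by
      have hj' : C₁ / ((1 / 2 - γ) / 2) ≤ Real.log (1 / νs j) := hj
      rw [div_le_iff₀ (by linarith)] at hj'
      linarith
  obtain ⟨j, hj⟩ := ((hgrowth δ hδ0).and (hreach.and (hevC.and
    (hlogν.eventually (eventually_ge_atTop 0))))).exists
  have hjg := hj.1
  have hjr := hj.2.1
  have hjC := hj.2.2.1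
  have hjν1 : (0 : ℝ) ≤ Real.log (1 / νs j) := hj.2.2.2
  obtain ⟨ν, hνdef⟩ : ∃ ν : ℝ, ν = νs j := ⟨_, rfl⟩
  have hνpos : 0 < ν := by rw [hνdef]; exact hν j
  obtain ⟨Λ, hΛ⟩ : ∃ Λ : ℝ, Λ = (R j : ℝ) * (S j).card * M j := ⟨_, rfl⟩
  have hΛ0 : 0 ≤ Λ := by rw [hΛ]; have := hM0 j; positivity
  obtain ⟨lg, hlg⟩ : ∃ lg : ℝ, lg = Real.log (1 / ν) := ⟨_, rfl⟩
  have hlg0 : 0 ≤ lg := by rw [hlg, hνdef]; exact hjν1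
  -- the window: `c = K₀ + R_j`, `n = ⌈c · exp (β Λ)⌉₊`
  obtain ⟨c, hcdef⟩ : ∃ c : ℕ, c = K₀ + R j := ⟨_, rfl⟩
  have hc1 : 1 ≤ c := by omega
  have hc0 : (0 : ℝ) < c := by exact_mod_cast hc1
  obtain ⟨n, hndef⟩ : ∃ n : ℕ, n = ⌈(c : ℝ) * Real.exp (β * Λ)⌉₊ := ⟨_, rfl⟩
  have hexp1 : 1 ≤ Real.exp (β * Λ) := Real.one_le_exp (by positivity)
  have hn_ge : (c : ℝ) * Real.exp (β * Λ) ≤ n := by rw [hndef]; exact Nat.le_ceil _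
  have hn1 : 1 ≤ n := by
    have : (1 : ℝ) ≤ n := le_trans (by nlinarith [hc0, hexp1, show (1:ℝ) ≤ c by exact_mod_cast hc1]) hn_ge
    exact_mod_cast this
  have hn_le : (n : ℝ) ≤ (c : ℝ) * Real.exp (β * Λ) + 1 := by rw [hndef]; exact (Nat.ceil_lt_add_one (by positivity)).le
  -- window from below: `β Λ ≤ H`
  have hH : β * Λ ≤ ∑ x ∈ Finset.range n, ((K₀ : ℝ) + R j + x)⁻¹ := by
    have h1 := log_window_le_harmonic hc1 n
    have h2 : β * Λ ≤ Real.log (((c : ℝ) + n) / c) := by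
      rw [← Real.log_exp (β * Λ)]
      refine Real.log_le_log (Real.exp_pos _) ?_
      rw [le_div_iff₀ hc0]
      nlinarith [hn_ge, hc0]
    refine h2.trans (h1.trans (le_of_eq (Finset.sum_congr rfl fun x _ => ?_)))
    rw [hcdef]; push_cast; ring
  have hKR : 1 ≤ K₀ + R j := by omega
  have hHpos : 0 < ∑ x ∈ Finset.range n, ((K₀ : ℝ) + R j + x)⁻¹ :=
    Finset.sum_pos (fun x _ => by
      have h0 : (0:ℝ) ≤ x := x.cast_nonneg
      have h1' : (1:ℝ) ≤ K₀ + R j := by exact_mod_cast hKR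
      exact inv_pos.2 (by linarith)) (Finset.nonempty_range_iff.2 (by omega))
  -- (a) the transfer term: `8π R #S M E' / H ≤ ε/8`
  have hAH : 8 * Real.pi * R j * (S j).card * M j * E' / (∑ x ∈ Finset.range n, ((K₀ : ℝ) + R j + x)⁻¹) ≤ ε / 8 := by
    rw [div_le_iff₀ hHpos]
    by_cases hΛz : Λ = 0
    · have : 8 * Real.pi * R j * (S j).card * M j * E' = 8 * Real.pi * E' * Λ := by rw [hΛ]; ring
      rw [this, hΛz, mul_zero]; positivity
    · have hΛpos : 0 < Λ := lt_of_le_of_ne hΛ0 (Ne.symm hΛz)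
      have e1 : (ε / 8) * β = 8 * Real.pi * E' := by
        rw [hβ]; field_simp; norm_num
      calc 8 * Real.pi * R j * (S j).card * M j * E' = ((ε / 8) * β) * Λ := by rw [e1, hΛ]; ring
        _ = (ε / 8) * (β * Λ) := by ring
        _ ≤ (ε / 8) * ∑ x ∈ Finset.range n, ((K₀ : ℝ) + R j + x)⁻¹ := by gcongr
  -- (b) the viscous term: `8π²ν(K₀+n)² E' ≤ ε/8`, via the logarithmic budget
  have hβΛ : β * Λ ≤ (1 / 2 - γ) / 4 * lg := by
    have h1 : Λ ≤ δ * lg := by rw [hΛ, hlg, hνdef]; exact hjg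
    have e : β * δ = (1 / 2 - γ) / 4 := by rw [hδ]; field_simp
    calc β * Λ ≤ β * (δ * lg) := mul_le_mul_of_nonneg_left h1 hβ0.le
      _ = (1 / 2 - γ) / 4 * lg := by rw [← mul_assoc, e]
  have hR1 : Real.log ((R j : ℝ) + 1) ≤ γ * lg := by rw [hlg, hνdef]; exact hjr
  have hC' : Real.log (64 * Real.pi ^ 2 * E' * 8 / ε) + 2 * Real.log 3 + 2 * Real.log ((K₀ : ℝ) + 1) ≤ (1 / 2 - γ) / 2 * lg := by
    rw [← hC₁, hlg, hνdef]; exact hjC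
  have hn_le' : (n : ℝ) ≤ ((K₀ : ℝ) + R j) * Real.exp (β * Λ) + 1 := by
    have : (c : ℝ) = (K₀ : ℝ) + R j := by rw [hcdef]; push_cast; ring
    rw [← this]; exact hn_le
  have hvisc : 8 * Real.pi ^ 2 * ν * ((K₀ : ℝ) + n) ^ 2 * E' ≤ ε / 8 :=
    quant_viscous_budget hε hE'0 hn1 hνpos hlg hΛ0 hβ0.le hn_le' hβΛ hR1 hC'
  -- (c) the tail coefficient
  have hηc : sourceTailMass K₀ K₀ h * ((1 + E') / 2) ≤ ε / 8 := by
    rw [← hη₀]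
    calc η₀ * ((1 + E') / 2) ≤ ε / (4 * (1 + E')) * ((1 + E') / 2) := by gcongr
      _ = ε / 8 := by field_simp; ring
  -- (d) one member cannot carry the floor
  have hEE' : E < E' := by rw [hE']; have := le_max_left E 0; linarith only [this]
  have hAH' : 8 * Real.pi * R j * (S j).card * M j * E' / (∑ x ∈ Finset.range n, ((K₀ : ℝ) + R j + x)⁻¹) ≤ ε / 8 := hAH
  rw [hνdef] at hvisc
  exact cell_member_no_floor (hν j) (hweak j) (hu j) hh hmean (hθ₀ j) (hc j) (hM j) (hM0 j) (htrans j) (hS j)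
    hKR hn1 hε hEE' hvisc hAH' hηc (hV j) (hfl j)

end Growing

end Summit.AnomalousDissipation.AnomalousDissipation.Theorems.ScalarAnomalySteadySourceFormal.Negative
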